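import Summits.ResolutionOfSingularities.ResolutionOfSingularities.Theorems.PurelyInseparableDim4ChartTransfer
import Literature.AlgebraicGeometry.Resolution.BlowupChartRatios
import Literature.AlgebraicGeometry.Resolution.BlowupRestrictOpen
import Literature.AlgebraicGeometry.Hironaka2017.Lib.SpecOrdersDiff
import HarnessLib

/-!
# Purely inseparable four-folds `z^p + F(x₁, …, x₄)`: the `x_j`-charts (`j ∈ S`) COVER the transform —
# the `z`-chart carries no point of positive order (brick TY-2 (g) of cell `res-dim4-pi`)

[OURS · counted 0] (D-0157 DOOR 2; director-resolution DR-157-C; desk row TY-2 / frame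
`PIDim4.TerminationImpliesOrderReduction`). The blowing up `π : W → 𝔸⁵_K` of `V(z, x_S)`
(`Λ_S = {z} ∪ {xⱼ : j ∈ S}`) is covered by `|S| + 1` affine-space charts (`AffineCoordBlowup.chartImm`,
one per coordinate of the centre); the cell's walk (`CentreBlowup.step`) only reads the `x_j`-charts,
`j ∈ S`. This file PROVES that nothing is lost: every point of `W` at which the controlled transform of
`(z^q + F)·𝒪` (`q ≠ 0`, `q ≤ ord_{(x_S)} F`) has POSITIVE order lies in some `x_j`-chart, `j ∈ S` — on the
`z`-chart the total transform is `z^q · (1 + G)` with `G ∈ (x_S)`, and `1 + G` is a unit wherever all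
`xⱼ` (`j ∈ S`) vanish, while where some `xⱼ` is invertible one is in the `x_j`-chart (the tree's chart
ratios `T = π^*xⱼ / π^*z`, `D(T) = W[z] ∩ W[xⱼ]`, `BlowupChartRatios.lean`). No `sorry`, no new axiom:

* `coordBlowupSubst_zero_rename_monomial`, `exists_coordBlowupSubst_zero_hyp` — the `z`-chart:
  `ψ₀(z^q + F) = z^q (1 + G)`, `G ∈ (xⱼ : j ∈ S)`;
* `controlledTransform_comap_chartImm_of_eq` — on ANY chart `i ∈ Λ_S` with `ψᵢ(z^q + F) = xᵢ^q · Q`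
  the controlled transform reads `Q·𝒪` (the `x_j`-charts are `…ChartTransfer`'s case `Q = z^q + F'`);
* `exists_X_succ_not_mem_of_one_le_idealOrder` — `ord_y((1 + G)·𝒪) ≥ 1 ⇒ some xⱼ ∉ 𝔓_y`;
* **`chartImm_zero_apply_mem_opensRange_succ`** — a point of the `z`-chart at which `xⱼ` (`j ∈ S`) is
  invertible lies in the `x_j`-chart;
* **`exists_mem_opensRange_chartImm_succ_of_one_le_idealOrder`**, **`support_transform_subset_iUnion`** —
  the cover statements: positive order ⇒ in some `x_j`-chart; `supp((𝔸⁵, (z^q+F)·𝒪, E, q)') ⊆ ⋃_{j ∈ S}`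
  `x_j`-charts.

Nothing here is a statement about resolution of singularities in dimension ≥ 4 / characteristic `p`
(NOT proved anywhere in this programme). bears_on: LADDER-RESOLUTION:D157-DOOR2 (res-dim4-pi). Supports
stmt-ResolutionOfSingularities-16155 (helper, TY-2 (g)).
-/

-- every declaration of this summit lives under `Summit.ResolutionOfSingularities.ResolutionOfSingularities`
-- (summit = problem), which the duplicate-namespace linter flags; house convention (cf. the Target file).
set_option linter.dupNamespace false

noncomputable section

open MvPolynomial Finset CategoryTheory AlgebraicGeometry Opposite TopologicalSpace
open AlgebraicGeometry.Scheme.IdealSheafData (ofIdealTop)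

namespace Summit.ResolutionOfSingularities.ResolutionOfSingularities.Theorems.PIDim4

open Literature.AlgebraicGeometry.Resolution
open Literature.AlgebraicGeometry.Resolution.AffinePointBlowup (P A γ coord Wtop ξ)
open Literature.AlgebraicGeometry.Hironaka2017.SpecOrders

namespace ChartDictionary

section ZChart

variable {K : Type} [Field K]

/-! ## §1 The `z`-chart: `ψ₀(z^q + F) = z^q · (1 + G)` with `G ∈ (x_S)` -/

/-- The coordinates of the centre as a FINSET: `insert 0 (S.map succ)`. -/
theorem coe_insert_map_succEmb (S : Finset (Fin 4)) :
    ((insert 0 (S.map (Fin.succEmb 4)) : Finset (Fin (4 + 1))) : Set (Fin (4 + 1))) =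
      insert 0 (Fin.succ '' (S : Set (Fin 4))) := by
  rw [Finset.coe_insert, Finset.coe_map, Fin.coe_succEmb]

/-- On the `z`-chart (`z ↦ z`, `xⱼ ↦ z·xⱼ` for `j ∈ S`) a monomial `c·x^d` of the base variables becomes
`z^{Σ_{j ∈ S} dⱼ} · c·x^d`. -/
theorem coordBlowupSubst_zero_rename_monomial (S : Finset (Fin 4)) (d : Fin 4 →₀ ℕ) (c : K) :
    coordBlowupSubst K (insert 0 (Fin.succ '' (S : Set (Fin 4)))) 0 (rename Fin.succ (monomial d c)) =
      X 0 ^ CentreBlowup.degIn S d * rename Fin.succ (monomial d c) := by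
  have h0 : (0 : Fin (4 + 1)) ∉ S.map (Fin.succEmb 4) := by
    intro h
    obtain ⟨i, -, hi⟩ := Finset.mem_map.mp h
    exact Fin.succ_ne_zero i (by rw [← Fin.coe_succEmb]; exact hi)
  have hsum : ∑ i ∈ (insert 0 (S.map (Fin.succEmb 4))).erase 0, (d.mapDomain Fin.succ) i =
      CentreBlowup.degIn S d := by
    rw [Finset.erase_insert h0, Finset.sum_map, CentreBlowup.degIn]
    refine Finset.sum_congr rfl fun i _ => ?_
    rw [show (Fin.succEmb 4) i = i.succ from congrFun Fin.coe_succEmb i,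
      Finsupp.mapDomain_apply (Fin.succ_injective 4)]
  rw [← coe_insert_map_succEmb, rename_monomial, coordBlowupSubst_monomial, hsum, X_pow_eq_monomial,
    monomial_mul, one_mul]

/-- A monomial of positive `S`-degree lies in the ideal `(xⱼ : j ∈ S)` of `K[z, x]`. -/
theorem rename_monomial_mem_span_of_degIn_ne_zero {S : Finset (Fin 4)} {d : Fin 4 →₀ ℕ}
    (hd : CentreBlowup.degIn S d ≠ 0) (c : K) :
    rename Fin.succ (monomial d c) ∈
      Ideal.span (X '' (Fin.succ '' (S : Set (Fin 4))) : Set (MvPolynomial (Fin (4 + 1)) K)) := by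
  obtain ⟨i, hi, hdi⟩ := Finset.exists_ne_zero_of_sum_ne_zero hd
  have hsplit : (monomial d c : MvPolynomial (Fin 4) K) = X i * monomial (d - Finsupp.single i 1) c := by
    rw [X, monomial_mul, one_mul,
      add_tsub_cancel_of_le (Finsupp.single_le_iff.mpr (Nat.one_le_iff_ne_zero.mpr hdi))]
  rw [hsplit, map_mul, rename_X]
  exact Ideal.mul_mem_right _ _ (Ideal.subset_span ⟨i.succ, ⟨i, hi, rfl⟩, rfl⟩)

/-- **The total transform on the `z`-chart**: for `q ≠ 0` and `q ≤ ord_{(x_S)} F`,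
`ψ₀(z^q + F) = z^q · (1 + G)` with `G ∈ (xⱼ : j ∈ S)` (`G = Σ_d c_d z^{|d|_S − q} x^d`). -/
theorem exists_coordBlowupSubst_zero_hyp {q : ℕ} (hq : q ≠ 0) (S : Finset (Fin 4))
    (F : MvPolynomial (Fin 4) K) (hperm : (q : ℕ∞) ≤ CentreBlowup.ordAlong S F) :
    ∃ G : MvPolynomial (Fin (4 + 1)) K,
      G ∈ Ideal.span (X '' (Fin.succ '' (S : Set (Fin 4))) : Set (MvPolynomial (Fin (4 + 1)) K)) ∧
      coordBlowupSubst K (insert 0 (Fin.succ '' (S : Set (Fin 4)))) 0 (hyp q F) = X 0 ^ q * (1 + G) := by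
  have hdeg : ∀ d ∈ F.support, q ≤ CentreBlowup.degIn S d := fun d hd => by
    have h : CentreBlowup.ordAlong S F ≤ (CentreBlowup.degIn S d : ℕ∞) := Finset.inf_le hd
    exact_mod_cast hperm.trans h
  refine ⟨∑ d ∈ F.support, X 0 ^ (CentreBlowup.degIn S d - q) * rename Fin.succ (monomial d (coeff d F)),
    Ideal.sum_mem _ fun d hd => Ideal.mul_mem_left _ _
      (rename_monomial_mem_span_of_degIn_ne_zero (by have := hdeg d hd; omega) _), ?_⟩
  rw [hyp, map_add, map_pow, coordBlowupSubst_X_self, mul_add, mul_one, Finset.mul_sum]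
  congr 1
  conv_lhs => rw [F.as_sum, map_sum, map_sum]
  refine Finset.sum_congr rfl fun d hd => ?_
  rw [coordBlowupSubst_zero_rename_monomial, ← mul_assoc, ← pow_add, Nat.add_sub_cancel' (hdeg d hd)]

/-! ## §2 The controlled transform on any chart from a factorisation `ψᵢ(z^q + F) = xᵢ^q · Q` -/

/-- Along `Spec ψᵢ` (`i ∈ Λ`): if `ψᵢ(z^q + F) = xᵢ^q · Q` then `(ψᵢ^*(z^q+F)·𝒪 : (xᵢ)^q) = Q·𝒪`. -/
theorem controlledTransform_specMap_subst_of_eq (q : ℕ) {Λ : Set (Fin (4 + 1))} {i : Fin (4 + 1)}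
    (hi : i ∈ Λ) (F : MvPolynomial (Fin 4) K) {Q : A 4 K}
    (hQ : coordBlowupSubst K Λ i (hyp q F) = X i ^ q * Q) :
    controlledTransform (Spec.map (CommRingCat.ofHom (coordBlowupSubst K Λ i).toRingHom))
        (AffineCoordBlowup.𝓘Λ 4 K Λ) (hypSheaf q F) q =
      ofIdealTop (Ideal.span {(γ 4 K).symm Q}) := by
  rw [controlledTransform, comap_𝓘Λ_specMap_subst hi, hypSheaf, ← ofIdealTop_pow, Ideal.span_singleton_pow,
    comap_ofIdealTop_span_γ_symm]
  change colon (ofIdealTop (Ideal.span {(γ 4 K).symm (coordBlowupSubst K Λ i (hyp q F))})) _ = _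
  rw [hQ, map_mul, map_pow]
  change colon (ofIdealTop (Ideal.span {coord 4 K i ^ q * (γ 4 K).symm Q}))
    (ofIdealTop (Ideal.span {coord 4 K i ^ q})) = _
  rw [colon_ofIdealTop, colon_span_singleton_mul_eq (coord_pow_mem_nonZeroDivisors i q)]

variable {S : Finset (Fin 4)} {W : Scheme.{0}} {π : W ⟶ P 4 K}

/-- **Controlled transform on the chart `i ∈ Λ_S` of ANY blowing up, from a factorisation**: if
`ψᵢ(z^q + F) = xᵢ^q · Q` then `(σᶜ((z^q+F)·𝒪, q)).comap (chartImm i) = Q·𝒪`. -/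
theorem controlledTransform_comap_chartImm_of_eq (q : ℕ) {i : Fin (4 + 1)}
    (hi : i ∈ (insert 0 (Fin.succ '' (S : Set (Fin 4))) : Set (Fin (4 + 1)))) (F : MvPolynomial (Fin 4) K)
    {Q : A 4 K} (hQ : coordBlowupSubst K (insert 0 (Fin.succ '' (S : Set (Fin 4)))) i (hyp q F) = X i ^ q * Q)
    (hπ : IsBlowup π (AffineCoordBlowup.𝓘Λ 4 K (insert 0 (Fin.succ '' (S : Set (Fin 4)))))) :
    (controlledTransform π (AffineCoordBlowup.𝓘Λ 4 K (insert 0 (Fin.succ '' (S : Set (Fin 4)))))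
        (hypSheaf q F) q).comap (AffineCoordBlowup.chartImm hπ hi) =
      ofIdealTop (Ideal.span {(γ 4 K).symm Q}) := by
  haveI : IsProper π := hπ.isProper
  haveI : IsLocallyNoetherian W := LocallyOfFiniteType.isLocallyNoetherian π
  have hsq : AffineCoordBlowup.chartImm hπ hi ≫ π =
      Spec.map (CommRingCat.ofHom
        (coordBlowupSubst K (insert 0 (Fin.succ '' (S : Set (Fin 4)))) i).toRingHom) ≫ 𝟙 (P 4 K) := by
    rw [Category.comp_id]
    exact AffineCoordBlowup.chartImm_comp hπ hi
  rw [comap_controlledTransform_of_flat (t := 𝟙 (P 4 K)) hsq, Scheme.IdealSheafData.comap_id,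
    Scheme.IdealSheafData.comap_id, controlledTransform_specMap_subst_of_eq q hi F hQ]

/-! ## §3 Positive order on the `z`-chart forces some `xⱼ`, `j ∈ S`, to be invertible -/

/-- The ideal sheaf of `γ⁻¹ a` on `𝔸ⁿ⁺¹` is `shf (a)` of the HIRONAKA-L library. -/
theorem ofIdealTop_span_γ_symm_eq_shf {n : ℕ} (a : A n K) :
    ofIdealTop (Ideal.span {(γ n K).symm a}) = shf (A n K) (Ideal.span {a}) := by
  rw [shf, Ideal.map_span, Set.image_singleton]
  rfl

/-- If `(1 + G)·𝒪` has positive order at `y` and `G ∈ (xⱼ : j ∈ S)`, then some `xⱼ`, `j ∈ S`, is not in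
`𝔓_y` (else `1 ∈ 𝔓_y`). -/
theorem exists_X_succ_not_mem_of_one_le_idealOrder {G : A 4 K}
    (hG : G ∈ Ideal.span (X '' (Fin.succ '' (S : Set (Fin 4))) : Set (MvPolynomial (Fin (4 + 1)) K)))
    {y : P 4 K} (hy : 1 ≤ idealOrder (ofIdealTop (Ideal.span {(γ 4 K).symm (1 + G)})) y) :
    ∃ j ∈ S, (X j.succ : A 4 K) ∉ y.asIdeal := by
  rw [ofIdealTop_span_γ_symm_eq_shf, one_le_idealOrder_shf_iff, Ideal.span_singleton_le_iff_mem] at hy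
  by_contra h
  push Not at h
  have hG' : G ∈ y.asIdeal := by
    refine (Ideal.span_le.mpr ?_) hG
    rintro _ ⟨_, ⟨j, hj, rfl⟩, rfl⟩
    exact h j (Finset.mem_coe.mp hj)
  have h1 : (1 : A 4 K) ∈ y.asIdeal := by
    have := y.asIdeal.sub_mem hy hG'
    rwa [add_sub_cancel_right] at this
  exact y.2.ne_top ((Ideal.eq_top_iff_one _).mpr h1)

/-! ## §4 Chart overlap: `xⱼ` invertible on the `z`-chart ⇒ in the `x_j`-chart -/

/-- **A point of the `z`-chart at which `xⱼ` (`j ∈ S`) does not vanish lies in the `x_j`-chart.**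
The ratio `T = π^*xⱼ / π^*z` on the `z`-chart (`IsBlowup.exists_chartRatio`) has `D(T) = W[z] ∩ W[xⱼ]`
(`IsBlowup.basicOpen_chartRatio`), and its pull-back to the affine space of the `z`-chart is `xⱼ`
(`π^*xⱼ ↦ z·xⱼ`, `π^*z ↦ z`, and `z` is a nonzerodivisor). -/
theorem chartImm_zero_apply_mem_opensRange_succ
    (hπ : IsBlowup π (AffineCoordBlowup.𝓘Λ 4 K (insert 0 (Fin.succ '' (S : Set (Fin 4))))))
    {j : Fin 4} (hj : j ∈ S) {y : P 4 K} (hy : (X j.succ : A 4 K) ∉ y.asIdeal) :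
    AffineCoordBlowup.chartImm hπ (zero_mem_centreVars S) y ∈
      (AffineCoordBlowup.chartImm hπ (succ_mem_centreVars hj)).opensRange := by
  have h0 := zero_mem_centreVars S
  have hj' := succ_mem_centreVars hj
  have h0I := AffineCoordBlowup.coord_mem_𝓘Λ 4 K _ h0
  have hjI := AffineCoordBlowup.coord_mem_𝓘Λ 4 K _ hj'
  -- the ratio `T = π^*xⱼ / π^*z` on the `z`-chart and its basic open
  obtain ⟨T, hT⟩ := hπ.exists_chartRatio (Wtop 4 K) h0I hjI
  have hbo := hπ.basicOpen_chartRatio (Wtop 4 K) h0I hjI hT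
  rw [AffineCoordBlowup.opensRange_chartImm hπ hj']
  change _ ∈ blowupChart π (AffineCoordBlowup.𝓘Λ 4 K (insert 0 (Fin.succ '' (S : Set (Fin 4))))) (Wtop 4 K)
    (coord 4 K j.succ)
  suffices hmem : AffineCoordBlowup.chartImm hπ h0 y ∈ W.basicOpen T by
    rw [hbo] at hmem
    exact hmem.2
  -- the `z`-chart `c₀ : 𝔸⁵ → W` and the open `V = c₀⁻¹ W[z]` (all of `𝔸⁵`)
  set c₀ := AffineCoordBlowup.chartImm hπ h0 with hc₀
  have hyV : y ∈ c₀ ⁻¹ᵁ blowupChart π (AffineCoordBlowup.𝓘Λ 4 K (insert 0 (Fin.succ '' (S : Set (Fin 4))))) (Wtop 4 K) (coord 4 K 0) := by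
    change c₀ y ∈ AffineCoordBlowup.chart (insert 0 (Fin.succ '' (S : Set (Fin 4)))) π 0
    rw [← AffineCoordBlowup.opensRange_chartImm hπ h0]
    exact ⟨y, rfl⟩
  change y ∈ c₀ ⁻¹ᵁ W.basicOpen T
  rw [Scheme.preimage_basicOpen]
  -- `𝔸⁵` is integral: sections over the nonempty `V` form a domain, restriction from `⊤` is injective
  haveI : Nonempty (P 4 K) := ⟨ξ 4 K⟩
  haveI : IsDomain Γ(P 4 K, ⊤) := AffinePointBlowup.isDomain_Γ 4 K
  haveI : IsIntegral (P 4 K) := isIntegral_of_isAffine_of_isDomain (P 4 K)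
  haveI : IsDomain Γ(P 4 K, c₀ ⁻¹ᵁ blowupChart π
      (AffineCoordBlowup.𝓘Λ 4 K (insert 0 (Fin.succ '' (S : Set (Fin 4))))) (Wtop 4 K) (coord 4 K 0)) :=
    @IsIntegral.component_integral (P 4 K) _ _ ⟨⟨y, hyV⟩⟩
  set ρ := (P 4 K).presheaf.map (homOfLE (le_top :
    c₀ ⁻¹ᵁ blowupChart π (AffineCoordBlowup.𝓘Λ 4 K (insert 0 (Fin.succ '' (S : Set (Fin 4))))) (Wtop 4 K)
      (coord 4 K 0) ≤ ⊤)).op with hρ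
  have hρinj : Function.Injective ρ :=
    map_injective_of_isIntegral (X := P 4 K) (homOfLE _) (H := ⟨⟨y, hyV⟩⟩)
  -- `c₀^*` of a pulled-back section `π^*s` is `(Spec ψ₀)^* s`, restricted to `V`
  have key : ∀ s : Γ(P 4 K, ⊤),
      c₀.app _ (π.appLE ⊤ _ (blowupChart_le_preimage π
        (AffineCoordBlowup.𝓘Λ 4 K (insert 0 (Fin.succ '' (S : Set (Fin 4))))) (Wtop 4 K) (coord 4 K 0)) s) =
        ρ ((Spec.map (CommRingCat.ofHom (coordBlowupSubst K
          (insert 0 (Fin.succ '' (S : Set (Fin 4)))) 0).toRingHom)).appTop s) := by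
    intro s
    rw [Scheme.Hom.app_eq_appLE, ← CommRingCat.comp_apply, Scheme.Hom.appLE_comp_appLE,
      appLE_congr_hom (AffineCoordBlowup.chartImm_comp hπ h0)]
    rfl
  have hTj := congrArg (c₀.app _) hT
  rw [map_mul, key, key] at hTj
  change ρ ((Spec.map _).appTop.hom ((γ 4 K).symm (X j.succ))) =
    ρ ((Spec.map _).appTop.hom ((γ 4 K).symm (X 0))) * _ at hTj
  rw [appTop_specMap_γ_symm, appTop_specMap_γ_symm] at hTj
  change ρ ((γ 4 K).symm (coordBlowupSubst K _ 0 (X j.succ))) =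
    ρ ((γ 4 K).symm (coordBlowupSubst K _ 0 (X 0))) * _ at hTj
  rw [coordBlowupSubst_X_self, coordBlowupSubst_X_of_mem_of_ne K _ 0 hj' (Fin.succ_ne_zero j),
    map_mul, map_mul] at hTj
  -- cancel `z`: the pull-back of `T` is `xⱼ` restricted to `V`
  have hz : ρ ((γ 4 K).symm (X 0)) ≠ 0 := fun h =>
    AffinePointBlowup.coord_ne_zero 4 K 0 (hρinj ((h.trans (map_zero _).symm : ρ (coord 4 K 0) = ρ 0)))
  have ht : c₀.app _ T = ρ ((γ 4 K).symm (X j.succ)) := (mul_left_cancel₀ hz hTj).symm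
  rw [ht, hρ, Scheme.basicOpen_res]
  refine ⟨hyV, ?_⟩
  change y ∈ (P 4 K).basicOpen ((γ 4 K).symm (X j.succ))
  rw [AffinePointBlowup.γ_symm_apply, basicOpen_eq_of_affine]
  exact hy

/-! ## §5 The cover statements -/

/-- **Positive order ⇒ in some `x_j`-chart (`j ∈ S`).** For `q ≠ 0`, `q ≤ ord_{(x_S)} F` and ANY blowing
up `π` of `𝔸⁵_K` along `V(z, x_S)`: every point of `W` at which the controlled transform
`σᶜ((z^q + F)·𝒪, q)` has order `≥ 1` lies in the `x_j`-chart of some `j ∈ S`. -/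
theorem exists_mem_opensRange_chartImm_succ_of_one_le_idealOrder {q : ℕ} (hq : q ≠ 0)
    (F : MvPolynomial (Fin 4) K) (hperm : (q : ℕ∞) ≤ CentreBlowup.ordAlong S F)
    (hπ : IsBlowup π (AffineCoordBlowup.𝓘Λ 4 K (insert 0 (Fin.succ '' (S : Set (Fin 4)))))) {w : W}
    (hw : 1 ≤ idealOrder (controlledTransform π
      (AffineCoordBlowup.𝓘Λ 4 K (insert 0 (Fin.succ '' (S : Set (Fin 4))))) (hypSheaf q F) q) w) :
    ∃ (j : Fin 4) (hj : j ∈ S), w ∈ (AffineCoordBlowup.chartImm hπ (succ_mem_centreVars hj)).opensRange := by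
  obtain ⟨⟨i, hi⟩, y, rfl⟩ := AffineCoordBlowup.exists_mem_opensRange_chartImm hπ w
  by_cases hi0 : i = 0
  · -- the `z`-chart: `1 + G ∈ 𝔓_y`, so some `xⱼ ∉ 𝔓_y`, so the point is in the `x_j`-chart
    subst hi0
    obtain ⟨G, hG, hQ⟩ := exists_coordBlowupSubst_zero_hyp hq S F hperm
    rw [← idealOrder_comap_of_isOpenImmersion (AffineCoordBlowup.chartImm hπ hi),
      controlledTransform_comap_chartImm_of_eq q hi F hQ hπ] at hw
    obtain ⟨j, hj, hyj⟩ := exists_X_succ_not_mem_of_one_le_idealOrder hG hw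
    exact ⟨j, hj, chartImm_zero_apply_mem_opensRange_succ hπ hj hyj⟩
  · -- an `x_j`-chart
    obtain ⟨j, rfl⟩ := Fin.exists_succ_eq.mpr hi0
    exact ⟨j, (succ_mem_centreVars_iff S j).mp hi, y, rfl⟩

/-- **The support of the transformed marked ideal is covered by the `x_j`-charts, `j ∈ S`**: for
`q ≠ 0`, `q ≤ ord_{(x_S)} F`, any boundary `E` and ANY blowing up `π` of `𝔸⁵_K` along `V(z, x_S)`,
`supp((𝔸⁵_K, (z^q + F)·𝒪, E, q).transform π 𝓘Λ) ⊆ ⋃_{j ∈ S} range(chartImm xⱼ)` — every point the walk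
must visit is a point of one of the charts the walk reads. -/
theorem support_transform_subset_iUnion {q : ℕ} (hq : q ≠ 0) (F : MvPolynomial (Fin 4) K)
    (hperm : (q : ℕ∞) ≤ CentreBlowup.ordAlong S F) (E : List (P 4 K).IdealSheafData)
    (hπ : IsBlowup π (AffineCoordBlowup.𝓘Λ 4 K (insert 0 (Fin.succ '' (S : Set (Fin 4)))))) :
    ((⟨hypSheaf q F, E, q⟩ : MarkedIdeal (P 4 K)).transform π
        (AffineCoordBlowup.𝓘Λ 4 K (insert 0 (Fin.succ '' (S : Set (Fin 4)))))).support ⊆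
      ⋃ (j : Fin 4) (hj : j ∈ S),
        ((AffineCoordBlowup.chartImm hπ (succ_mem_centreVars hj)).opensRange : Set W) := by
  intro w hw
  have hw1 : 1 ≤ idealOrder (controlledTransform π
      (AffineCoordBlowup.𝓘Λ 4 K (insert 0 (Fin.succ '' (S : Set (Fin 4))))) (hypSheaf q F) q) w :=
    le_trans (by exact_mod_cast Nat.one_le_iff_ne_zero.mpr hq) hw
  obtain ⟨j, hj, hwj⟩ := exists_mem_opensRange_chartImm_succ_of_one_le_idealOrder hq F hperm hπ hw1
  exact Set.mem_iUnion₂.mpr ⟨j, hj, hwj⟩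

end ZChart

end ChartDictionary

end Summit.ResolutionOfSingularities.ResolutionOfSingularities.Theorems.PIDim4

end
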